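import Summits.RiemannHypothesis.RiemannHypothesis.Theorems.IntegerScrewScrewPolyFloorLandauTailFloorSharp
import Summits.RiemannHypothesis.RiemannHypothesis.Theorems.IntegerScrewScrewPolyFloorLandauVisibility
import HarnessLib

/-!
# Route IntegerScrew — VisibilityCubed: RH up to height `M³` certifies rung `M` (RH-free reduction)

Helper file for crux `IntegerScrew.ScrewPolyFloor` (stmt-RiemannHypothesis-15757), idea card
`Cruxes/ScrewPolyFloor/Ideas/abscissa-blind-head.md` (VisibilityCubed / ConverseVisibility). Sharp
forms of `screwFloor_of_rhUpTo` and `offLine_zero_of_rung_failure`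
(`IntegerScrewScrewPolyFloorLandauVisibility.lean`, height `M¹⁶`), from `tailFloor_sharp`:

* `screwFloor_of_rhUpTo_sharp` — there are `c > 0` (`c = 1/2π`) and `M₀` with: for `M ≥ M₀`, if every
  zero of `ζ` with `0 < Im ρ ≤ M³` lies on the critical line (`RiemannHypothesisUpTo (M³)`), then
  `c (log M)/M³ ∑_{2≤m≤M} x_m² ≤ ∑_{2≤m,m'≤M} G(log m, log m') x_m x_m'` for all real `x` — the crux
  inequality `ScrewPolyFloor` at rung `M` with `A = 3`;
* `offLine_zero_of_rung_failure_sharp` — contrapositive: a rung `M ≥ M₀` failing this inequality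
  exhibits a zero off the critical line of height `≤ M³`.

Both are RH-free theorems; with RH they give the crux inequality for all `M ≥ M₀` with `A = 3`.
The exponent `3` is one application of Cauchy–Schwarz away from the natural limit `2 + ε` of the
method (the Landau pairing of length-`M` Dirichlet polynomials has an RH-free error `O(M²)` per unit
of `∑ y²`, so windows of `≫ M^{2+ε}` zeros are positive reservoirs).
-/

noncomputable section

open Complex Finset
open scoped Real ComplexConjugate

-- the layout-mandated namespace repeats the summit name
set_option linter.dupNamespace false

namespace Summit.RiemannHypothesis.RiemannHypothesis.Theorems.IntegerScrewLandau

open Literature.NumberTheory.LFunctions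

/-- **VisibilityCubed (RH to height `M³` ⇒ the floor at rung `M`).** There are `c > 0` and `M₀`
such that for every `M ≥ M₀`: if every zero of `ζ` with `0 < Im ρ ≤ M³` lies on the critical line
(`RiemannHypothesisUpTo (M³)`), then for all real `x`,
`c·(log M)/M³·∑_{2≤m≤M} x_m² ≤ ∑_{2≤m,m'≤M} G(log m, log m') x_m x_m'` — the crux inequality at rung
`M` with `A = 3` (`tailFloor_sharp` + `headTerm_re_nonneg`; `y = x` on `[2,M]`, `y_1 = −∑x`). [folklore] -/
theorem screwFloor_of_rhUpTo_sharp :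
    ∃ (c : ℝ) (M₀ : ℕ), 0 < c ∧ ∀ M : ℕ, M₀ ≤ M →
      Literature.NumberTheory.DiophantineGeometry.RiemannHypothesisUpTo ((M : ℝ) ^ 3) →
        ∀ x : ℕ → ℝ, c * Real.log M / (M : ℝ) ^ 3 * ∑ m ∈ Icc 2 M, x m ^ 2 ≤
          ∑ m ∈ Icc 2 M, ∑ m' ∈ Icc 2 M,
            zetaScrewKernel (Real.log m) (Real.log m') * (x m * x m') := by
  obtain ⟨c, M₀, hc, htail⟩ := tailFloor_sharp
  refine ⟨c, max M₀ 1, hc, fun M hM hRH x ↦ ?_⟩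
  classical
  have hM₀ : M₀ ≤ M := (le_max_left _ _).trans hM
  have hM1 : 1 ≤ M := (le_max_right _ _).trans hM
  -- the balanced extension
  set y : ℕ → ℝ := fun m ↦ if m = 1 then -∑ k ∈ Icc 2 M, x k else x m with hy
  have hy2 : ∀ m ∈ Icc 2 M, y m = x m := fun m hm ↦ by
    rw [Finset.mem_Icc] at hm
    simp [hy, show m ≠ 1 by omega]
  have hsplit : Icc 1 M = insert 1 (Icc 2 M) := by
    ext k; simp only [Finset.mem_Icc, Finset.mem_insert]; omega
  have h1notin : (1 : ℕ) ∉ Icc 2 M := by simp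
  have hbal : ∑ m ∈ Icc 1 M, y m = 0 := by
    rw [hsplit, Finset.sum_insert h1notin, Finset.sum_congr rfl hy2]
    simp [hy]
  have hnorm : ∑ m ∈ Icc 2 M, x m ^ 2 ≤ ∑ m ∈ Icc 1 M, y m ^ 2 := by
    have e : ∑ m ∈ Icc 2 M, y m ^ 2 = ∑ m ∈ Icc 2 M, x m ^ 2 :=
      Finset.sum_congr rfl fun m hm ↦ by rw [hy2 m hm]
    rw [hsplit, Finset.sum_insert h1notin, e]
    linarith [sq_nonneg (y 1)]
  have hform : ∑ m ∈ Icc 2 M, ∑ m' ∈ Icc 2 M, zetaScrewKernel (Real.log m) (Real.log m') * (y m * y m') =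
      ∑ m ∈ Icc 2 M, ∑ m' ∈ Icc 2 M, zetaScrewKernel (Real.log m) (Real.log m') * (x m * x m') :=
    Finset.sum_congr rfl fun m hm ↦ Finset.sum_congr rfl fun m' hm' ↦ by rw [hy2 m hm, hy2 m' hm']
  have h := htail M hM₀ y hbal
  rw [hform] at h
  -- the head is non-negative under RH up to `M³`
  have hhead : 0 ≤ (∑ ρ ∈ SchoenfeldBound.zerosUpTo ((M : ℝ) ^ 3),
      (riemannZetaZeroOrder (ρ : ℂ) : ℂ) *
        (-((∑ m ∈ Icc 1 M, ((y m : ℝ) : ℂ) * (m : ℂ) ^ ((ρ : ℂ) - 1 / 2)) *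
            ∑ m ∈ Icc 1 M, ((y m : ℝ) : ℂ) * (m : ℂ) ^ (-((ρ : ℂ) - 1 / 2))) /
          ((ρ : ℂ) - 1 / 2) ^ 2)).re := by
    rw [Complex.re_sum]
    refine Finset.sum_nonneg fun ρ hρ ↦ ?_
    rw [SchoenfeldBound.mem_zerosUpTo] at hρ
    have hmem : (ρ : ℂ) ∈ RHWave0.riemannZetaNontrivialZeros := ρ.2
    have hζ := ZetaZeros.riemannZetaNontrivialZeros.zeta_eq_zero hmem
    have him := ZetaZeros.riemannZetaNontrivialZeros.im_ne_zero hmem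
    have hk : 0 ≤ riemannZetaZeroOrder (ρ : ℂ) :=
      riemannZetaZeroOrder_nonneg (ZetaZeros.riemannZetaNontrivialZeros.ne_one hmem)
    have hre : ((ρ : ℂ)).re = 1 / 2 := by
      rcases lt_or_gt_of_ne him with hneg | hposim
      · -- use the conjugate zero
        have hc := hRH (conj (ρ : ℂ)) (by rw [riemannZeta_conj, hζ, map_zero])
          (by rw [Complex.conj_im]; linarith)
          (by rw [Complex.conj_im]; rw [abs_of_neg hneg] at hρ; linarith)
        rwa [Complex.conj_re] at hc
      · exact hRH _ hζ hposim (by rw [abs_of_pos hposim] at hρ; exact hρ)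
    exact headTerm_re_nonneg M y hre him hk
  have hlogM : 0 ≤ c * Real.log M / (M : ℝ) ^ 3 := by
    have : (1 : ℝ) ≤ M := by exact_mod_cast hM1
    have := Real.log_nonneg this
    positivity
  calc c * Real.log M / (M : ℝ) ^ 3 * ∑ m ∈ Icc 2 M, x m ^ 2
      ≤ c * Real.log M / (M : ℝ) ^ 3 * ∑ m ∈ Icc 1 M, y m ^ 2 := mul_le_mul_of_nonneg_left hnorm hlogM
    _ ≤ _ := by linarith

/-- **ConverseVisibility, cubed (a failing rung exhibits an off-line zero below `M³`).** With the same `c > 0`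
and `M₀` as in `screwFloor_of_rhUpTo`: if for some `M ≥ M₀` and some real `x` the crux inequality
`c·(log M)/M³·∑_{2≤m≤M} x_m² ≤ ∑_{2≤m,m'≤M} G(log m, log m') x_m x_m'` FAILS, then `ζ` has a zero
`ρ` off the critical line with `0 < Im ρ ≤ M³` (contrapositive of `screwFloor_of_rhUpTo_sharp`). [folklore] -/
theorem offLine_zero_of_rung_failure_sharp :
    ∃ (c : ℝ) (M₀ : ℕ), 0 < c ∧ ∀ M : ℕ, M₀ ≤ M → ∀ x : ℕ → ℝ,
      ∑ m ∈ Icc 2 M, ∑ m' ∈ Icc 2 M, zetaScrewKernel (Real.log m) (Real.log m') * (x m * x m') <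
          c * Real.log M / (M : ℝ) ^ 3 * ∑ m ∈ Icc 2 M, x m ^ 2 →
        ∃ ρ : ℂ, riemannZeta ρ = 0 ∧ 0 < ρ.im ∧ ρ.im ≤ (M : ℝ) ^ 3 ∧ ρ.re ≠ 1 / 2 := by
  obtain ⟨c, M₀, hc, h⟩ := screwFloor_of_rhUpTo_sharp
  refine ⟨c, M₀, hc, fun M hM x hlt ↦ ?_⟩
  by_contra hno
  push Not at hno
  exact absurd (h M hM (fun s hs h0 hT ↦ hno s hs h0 hT) x) (not_le.mpr hlt)

end Summit.RiemannHypothesis.RiemannHypothesis.Theorems.IntegerScrewLandau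

end
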